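import Summits.BirchSwinnertonDyer.BirchSwinnertonDyer.Theses.GenusKolyvaginAtTwo

/-!
# Route `GenusKolyvaginAtTwo`, crux #3 `KolyvaginExactAtTwo` (stmt-BirchSwinnertonDyer-22137):
# the `p = 2` "Frobenius-halves" lemma — why level-`1` Kolyvagin primes are too shallow when
# `Δ_E > 0` (helper, PROVED; seat `bsd-line-gk2-p2`, line `birth`)

McCallum's port of Kolyvagin's structure theorem (the crux, registered stubs
`GenusExact.stub_upperBoundAtTwo` / `GenusExact.stub_lowerBoundAtTwo`) runs on the localisations
of derived classes `c_M(n)` at Kolyvagin primes `λ ∣ ℓ`: by McCallum 1991 Prop. 4.4 (1),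
`c_M(ℓm)_λ = χ_ℓ(P_m)` is governed by the `2^M`-divisibility of `P_m` in `E(K_λ)`, i.e. (Hensel,
`ℓ` odd) of its reduction in `Ẽ(𝔽_λ) = Ẽ(𝔽_{ℓ²})`, on which `Gal(K_λ/ℚ_ℓ)` acts through the
Frobenius `F = Frob_ℓ` with `F² = Frob_λ`. At `p = 2` there is an elementary degeneracy with no
odd-`p` analogue, isolated here as pure group theory:

* `frob_frob_eq_of_two_smul_eq` — if an additive endomorphism `F` of `A` FIXES EVERY `2`-TORSION
  ELEMENT of `A` and `F P = P`, then `F (F Q) = Q` for every half `Q` of `P` (`2 • Q = P`):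
  `F` moves a half of `P` by a `2`-torsion element, which it fixes, so `F²` fixes the half;
* `frob_frob_eq_of_two_smul_eq_of_add` / `…_of_neg` — the same when `F P = P + 2 • R` with
  `F R = -R`, resp. `F P = -P + 2 • R` with `F R = R` (the shape forced on a `τ`-eigenvector
  modulo `2` of a `2`-torsion-free group, `neg_eq_of_involutive_of_eq_add_two_smul` /
  `eq_of_involutive_of_eq_neg_add_two_smul`);
* `exists_half_fixed_of_map` — assembled along an equivariant additive map `red : B →+ A`
  (`red ∘ τ = F ∘ red`) from a `2`-torsion-free group `B` with an involution `τ`: if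
  `τ P ≡ ± P (mod 2B)` and `red P` has a half in `A`, it has a half fixed by `F ∘ F`.

APPLICATION (why this serves the crux; nothing below is claimed as a theorem of the tree).
Take `B = E(K_m)` (`m = n/ℓ`; no `2`-torsion by Gross's Lemma 4.3 at `2`, tree
`Theorems.ringClassField_one_two_torsion_eq_zero` for `m = 1`), `τ` a generator of the
decomposition group of a prime `λ_m ∣ λ` in the generalised-dihedral group `Gal(K_m/ℚ)` (an
involution), `P = P_m` (a `τ`-eigenvector mod `2E(K_m)` by Gross 1991 Prop. 5.4, whose proof is
`2`-integral), `A = Ẽ(\bar 𝔽_ℓ)` (`2`-divisible), `red` = reduction mod `λ_m`, `F = Frob_ℓ`. The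
hypothesis "`F` fixes `A[2] = E[2]`" says `E[2] ⊂ E(𝔽_ℓ)`; for a prime `ℓ` in Kolyvagin's class
`Frob_ℓ = Frob_∞` of `Gal(K(E[2])/ℚ)` (Gross (3.2) at `p = 2`, `M = 1`) this holds EXACTLY WHEN
`Δ_E > 0` (complex conjugation fixes `E[2]` iff `E[2] ⊂ E(ℝ)` iff `Δ_E > 0`). Conclusion:
`P̃_m ∈ 2Ẽ(𝔽_{ℓ²})`, so `P_m ∈ 2E(K_λ)` and `c_1(n)_λ = χ_ℓ(P_m) = 0` — for `Δ_E > 0` the mod-`2`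
(level `M = 1`) derived classes at `τ`-class Kolyvagin primes are locally trivial at their own
primes, i.e. lie in `Sel₂(E/K)`; a level-`1` certificate `P(n) ∉ 2E(K[n])` of the crux is then a
non-zero `2`-SELMER class, and McCallum's bootstrapping `P_m ∉ pE(K_λ) ⇒ P_{mℓ} ∉ pE(K_{mℓ})`
(Cor. 4.5) can never fire. This is the precise form of the crux's "why it might fail" («level-1
Kolyvagin primes (2 ∥ ℓ+1) may be too shallow»), and it is one half of a sign-of-`Δ` dichotomy
(`T₂E ≅ ℤ₂ ⊕ ℤ₂⁻` iff `Δ_E > 0`, `≅ ℤ₂[C₂]` iff `Δ_E < 0`; memo `ANALYSIS-22137.md`, evidence on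
the item). For odd `p` the hypothesis "`F` fixes `A[p]`" never holds at a Kolyvagin prime (`τ` has
the eigenvalue `−1 ≠ 1` on `E[p]`), which is why the phenomenon is invisible in print.
BSD is not proved by any of this.

References: [McCallumLMS1991] §3 Prop. 3.1, §4 Lemma 4.3, Prop. 4.4, Cor. 4.5; [GrossLMS1991]
§3 (3.2)–(3.3), Lemma 4.3, Prop. 5.4, Prop. 6.2.
-/

set_option linter.dupNamespace false

namespace Summit.BirchSwinnertonDyer.BirchSwinnertonDyer.Theorems.GenusExact

/-! ### Halves of Frobenius-fixed points when Frobenius fixes the `2`-torsion -/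

section Halves

variable {A : Type*} [AddCommGroup A] (F : A →+ A)

/-- **Frobenius-halves lemma (`ε = +1`).** If the additive endomorphism `F` fixes every
`2`-torsion element of `A` and fixes `P`, then `F ∘ F` fixes every half `Q` of `P`: indeed
`2 • (F Q - Q) = F P - P = 0`, so `F` fixes `F Q - Q`, whence `F (F Q) = F Q + (F Q - Q) = Q + 2 • (F Q - Q) = Q`.
(At a prime `ℓ` with `E[2] ⊂ E(𝔽_ℓ)`: every `𝔽_ℓ`-point of `E` is `2`-divisible in `E(𝔽_{ℓ²})`.) [folklore] -/
theorem frob_frob_eq_of_two_smul_eq (hF : ∀ T : A, 2 • T = 0 → F T = T) {P Q : A}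
    (hP : F P = P) (hQ : 2 • Q = P) : F (F Q) = Q := by
  have hT : F (F Q - Q) = F Q - Q := by
    refine hF _ ?_
    rw [smul_sub, ← map_nsmul, hQ, hP, sub_self]
  have h1 : F (F Q) - F Q = F Q - Q := by rw [← map_sub, hT]
  -- `F (F Q) = 2 • F Q - Q = Q + 2 • (F Q - Q) = Q`
  have h2 : 2 • (F Q - Q) = 0 := by rw [smul_sub, ← map_nsmul, hQ, hP, sub_self]
  have h3 : F (F Q) = Q + 2 • (F Q - Q) := by
    rw [two_nsmul]
    -- rearrange `F (F Q) - F Q = F Q - Q`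
    calc F (F Q) = (F (F Q) - F Q) + F Q := by abel
      _ = (F Q - Q) + F Q := by rw [h1]
      _ = Q + (F Q - Q + (F Q - Q)) := by abel
  rw [h3, h2, add_zero]

/-- **Frobenius-halves lemma, `F P = P + 2 • R` with `F R = -R`.** If `F` fixes the `2`-torsion
of `A` pointwise, `F P = P + 2 • R` with `F R = -R`, and `2 • Q = P`, then `F (F Q) = Q`
(put `T = F Q - Q - R`: `2 • T = 0`, so `F T = T`, and `F (F Q) = F (Q + R + T) = Q`). [folklore] -/
theorem frob_frob_eq_of_two_smul_eq_of_add (hF : ∀ T : A, 2 • T = 0 → F T = T) {P Q R : A}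
    (hP : F P = P + 2 • R) (hR : F R = -R) (hQ : 2 • Q = P) : F (F Q) = Q := by
  set T := F Q - Q - R with hTdef
  have h2T : 2 • T = 0 := by
    rw [hTdef, smul_sub, smul_sub, ← map_nsmul, hQ, hP]
    abel
  have hFT : F T = T := hF T h2T
  have hFQ : F Q = Q + R + T := by rw [hTdef]; abel
  calc F (F Q) = F (Q + R + T) := by rw [hFQ]
    _ = F Q + F R + F T := by rw [map_add, map_add]
    _ = (Q + R + T) + -R + T := by rw [hFQ, hR, hFT]
    _ = Q + 2 • T := by rw [two_nsmul]; abel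
    _ = Q := by rw [h2T, add_zero]

/-- **Frobenius-halves lemma, `F P = -P + 2 • R` with `F R = R`.** If `F` fixes the `2`-torsion
of `A` pointwise, `F P = -P + 2 • R` with `F R = R`, and `2 • Q = P`, then `F (F Q) = Q`
(put `T = F Q + Q - R`). [folklore] -/
theorem frob_frob_eq_of_two_smul_eq_of_neg (hF : ∀ T : A, 2 • T = 0 → F T = T) {P Q R : A}
    (hP : F P = -P + 2 • R) (hR : F R = R) (hQ : 2 • Q = P) : F (F Q) = Q := by
  set T := F Q + Q - R with hTdef
  have h2T : 2 • T = 0 := by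
    rw [hTdef, smul_sub, smul_add, ← map_nsmul, hQ, hP]
    abel
  have hFT : F T = T := hF T h2T
  have hFQ : F Q = -Q + R + T := by rw [hTdef]; abel
  calc F (F Q) = F (-Q + R + T) := by rw [hFQ]
    _ = -F Q + F R + F T := by rw [map_add, map_add, map_neg]
    _ = -(-Q + R + T) + R + T := by rw [hFQ, hR, hFT]
    _ = Q := by abel

end Halves

/-! ### The eigenvector-mod-`2` shape in a `2`-torsion-free group with an involution -/

section Involution

variable {B : Type*} [AddCommGroup B] (τ : B →+ B)

/-- In a group without `2`-torsion, if `τ` is an involution and `τ P = P + 2 • R`, then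
`τ R = -R`: apply `τ` again, `P = P + 2 • R + 2 • τ R`, so `2 • (R + τ R) = 0`. (Shape of a
`+`-eigenvector modulo `2E(K_m)` of a complex conjugation on `E(K_m)`, `E(K_m)[2] = 0`.) [folklore] -/
theorem neg_eq_of_involutive_of_eq_add_two_smul (h2 : ∀ x : B, 2 • x = 0 → x = 0)
    (hτ : ∀ x : B, τ (τ x) = x) {P R : B} (hP : τ P = P + 2 • R) : τ R = -R := by
  have h : 2 • (R + τ R) = 0 := by
    have hPP : P = P + 2 • R + 2 • τ R := by
      conv_lhs => rw [← hτ P, hP, map_add, map_nsmul, hP]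
    have : P + (2 • R + 2 • τ R) = P + 0 := by rw [add_zero, ← add_assoc]; exact hPP.symm
    rw [smul_add]
    exact add_left_cancel this
  have h0 := h2 _ h
  exact (neg_eq_of_add_eq_zero_right h0).symm

/-- In a group without `2`-torsion, if `τ` is an involution and `τ P = -P + 2 • R`, then
`τ R = R`. (Shape of a `−`-eigenvector modulo `2E(K_m)`.) [folklore] -/
theorem eq_of_involutive_of_eq_neg_add_two_smul (h2 : ∀ x : B, 2 • x = 0 → x = 0)
    (hτ : ∀ x : B, τ (τ x) = x) {P R : B} (hP : τ P = -P + 2 • R) : τ R = R := by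
  have h : 2 • (τ R - R) = 0 := by
    have hPP : P = P - 2 • R + 2 • τ R := by
      conv_lhs => rw [← hτ P, hP, map_add, map_neg, map_nsmul, hP]
      abel
    have : P + (2 • τ R - 2 • R) = P + 0 := by
      rw [add_zero]
      calc P + (2 • τ R - 2 • R) = P - 2 • R + 2 • τ R := by abel
        _ = P := hPP.symm
    rw [smul_sub]
    exact add_left_cancel this
  have h0 := h2 _ h
  exact sub_eq_zero.mp h0

end Involution

/-! ### Assembly along an equivariant map (reduction modulo `λ`) -/

section Assembly

variable {A B : Type*} [AddCommGroup A] [AddCommGroup B] (F : A →+ A) (τ : B →+ B)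
  (red : B →+ A)

/-- **Assembled form.** Let `B` be `2`-torsion-free with an involution `τ`, `A` a group on which
`F` fixes every `2`-torsion element, and `red : B →+ A` equivariant (`red (τ x) = F (red x)`).
If `τ P ≡ P` or `τ P ≡ -P` modulo `2 • B` and `red P` has a half in `A`, then `red P` has a half
FIXED BY `F ∘ F`. (Dictionary: `B = E(K_m)`, `τ` a decomposition-group involution at `λ_m`,
`A = Ẽ(\bar 𝔽_ℓ)`, `F = Frob_ℓ`, `red` = reduction; "`F` fixes `A[2]`" = "`E[2] ⊂ E(𝔽_ℓ)`", true at
`τ`-class Kolyvagin primes at `2` iff `Δ_E > 0`; conclusion: `P̃_m ∈ 2Ẽ(𝔽_{ℓ²})`, hence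
`P_m ∈ 2E(K_λ)` and `c_1(mℓ)_λ = 0` by McCallum Prop. 4.4 (1).)
[cite: McCallumLMS1991, §4 Prop. 4.4 (1), Cor. 4.5] [cite: GrossLMS1991, §5 Prop. 5.4] -/
theorem exists_half_fixed_of_map (hF : ∀ T : A, 2 • T = 0 → F T = T)
    (h2 : ∀ x : B, 2 • x = 0 → x = 0) (hτ : ∀ x : B, τ (τ x) = x)
    (hred : ∀ x : B, red (τ x) = F (red x)) {P R : B}
    (hP : τ P = P + 2 • R ∨ τ P = -P + 2 • R) (hhalf : ∃ Q : A, 2 • Q = red P) :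
    ∃ Q : A, F (F Q) = Q ∧ 2 • Q = red P := by
  obtain ⟨Q, hQ⟩ := hhalf
  refine ⟨Q, ?_, hQ⟩
  rcases hP with hP | hP
  · have hR : τ R = -R := neg_eq_of_involutive_of_eq_add_two_smul τ h2 hτ hP
    have hP' : F (red P) = red P + 2 • red R := by
      rw [← hred, hP, map_add, map_nsmul]
    have hR' : F (red R) = -red R := by rw [← hred, hR, map_neg]
    exact frob_frob_eq_of_two_smul_eq_of_add F hF hP' hR' hQ
  · have hR : τ R = R := eq_of_involutive_of_eq_neg_add_two_smul τ h2 hτ hP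
    have hP' : F (red P) = -red P + 2 • red R := by
      rw [← hred, hP, map_add, map_neg, map_nsmul]
    have hR' : F (red R) = red R := by rw [← hred, hR]
    exact frob_frob_eq_of_two_smul_eq_of_neg F hF hP' hR' hQ

end Assembly

/-! ### The sign-of-`Δ` dichotomy for the norm `1 ± τ` (appended, same seat)

McCallum's Čebotarev step (Prop. 3.1 / Cor. 3.2) realises at a Kolyvagin prime `λ` the local values
`c_λ = (1 + η τ) e`, `e` ranging over `E[2^{M_c}]`, for a `τ`-eigenclass `c` of sign `η` and order
`2^{M_c}` (at `p = 2` the realisable Frobenius characters are NORMS `(1+τ)ψ`, not `τ`-invariants).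
Two elementary facts decide what these norms can be:
* `two_pow_pred_smul_norm_eq_zero` (SPLIT case, `Δ_E > 0`): if `τ` fixes every `2`-torsion element
  (⟺ `τ ≡ 1 (mod 2)` ⟺ `E[2] ⊂ E(ℝ)`), then for `2^(k+1) • e = 0` both `e + τ e` and `e - τ e` are
  killed by `2^k` — the norm loses (at least) one factor `2`, so `ord c_λ ≤ (ord c)/2`; at `k = 0`
  (classes mod `2`) the norm vanishes;
* `norm_swap_eq_zero_iff` (FREE case, `Δ_E < 0`): on the free module `R × R` with `τ (x, y) = (y, x)`
  the norm `(x, y) ↦ (x + y, x + y)` vanishes iff `y = -x`, so its image `{(s, s)}` is a copy of `R`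
  (`exists_norm_swap_eq`): norms of elements of exact order `2^M` realise every order — full local
  orders are realisable.
References: [McCallumLMS1991] §3 Prop. 3.1, Cor. 3.2.
-/

section NormDichotomy

variable {A : Type*} [AddCommGroup A] (τ : A →+ A)

/-- **Split case (`Δ_E > 0`): the norm `1 ± τ` loses a factor `2`.** If the additive endomorphism
`τ` fixes every `2`-torsion element of `A` and `2^(k+1) • e = 0`, then `2^k • (e + τ e) = 0` and
`2^k • (e - τ e) = 0`: indeed `2^k • e` is `2`-torsion, hence fixed by `τ`, so
`2^k • (τ e - e) = 0`, and `2^k • (e + τ e) = 2^k • (τ e - e) + 2^(k+1) • e`. [folklore] -/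
theorem two_pow_pred_smul_norm_eq_zero (hτ : ∀ T : A, 2 • T = 0 → τ T = T) {k : ℕ} {e : A}
    (he : 2 ^ (k + 1) • e = 0) : 2 ^ k • (e + τ e) = 0 ∧ 2 ^ k • (e - τ e) = 0 := by
  have h2 : 2 • (2 ^ k • e) = 0 := by rw [smul_smul, ← pow_succ', he]
  have hfix : τ (2 ^ k • e) = 2 ^ k • e := hτ _ h2
  rw [map_nsmul] at hfix
  have hsub : 2 ^ k • (e - τ e) = 0 := by rw [smul_sub, hfix, sub_self]
  refine ⟨?_, hsub⟩
  have : 2 ^ k • (e + τ e) = 2 ^ k • (e - τ e) + 2 • (2 ^ k • τ e) := by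
    rw [smul_sub, smul_add, two_nsmul]; abel
  rw [this, hsub, zero_add, hfix, h2]

/-- In particular, for classes modulo `2` (`k = 0`): if `τ` fixes `A[2]` pointwise and `2 • e = 0`
then `e + τ e = 0` — the norm of a `2`-torsion element vanishes. [folklore] -/
theorem norm_eq_zero_of_two_smul_eq_zero (hτ : ∀ T : A, 2 • T = 0 → τ T = T) {e : A}
    (he : 2 • e = 0) : e + τ e = 0 := by
  have h := (two_pow_pred_smul_norm_eq_zero τ hτ (k := 0) (e := e) (by simpa using he)).1
  simpa using h

end NormDichotomy

section FreeCase

variable {R : Type*} [AddCommGroup R]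

/-- **Free case (`Δ_E < 0`): the norm of the swap involution on `R × R`.** For `τ (x, y) = (y, x)`
the norm `(x, y) + τ (x, y) = (x + y, x + y)` vanishes iff `y = -x`. [folklore] -/
theorem norm_swap_eq_zero_iff (x y : R) :
    (x, y) + (AddEquiv.prodComm : R × R ≃+ R × R) (x, y) = 0 ↔ y = -x := by
  simp only [AddEquiv.coe_prodComm, Prod.swap_prod_mk, Prod.mk_add_mk, Prod.mk_eq_zero,
    add_comm y x, and_self]
  exact add_eq_zero_iff_neg_eq.trans ⟨fun h ↦ h.symm, fun h ↦ h.symm⟩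

/-- **Free case: every diagonal element is a norm.** For every `s : R`, `(s, s) = (s, 0) + τ (s, 0)`
for the swap `τ`; so the norms form the full diagonal copy of `R` — in `E[2^M] ≅ (ℤ/2^M)[⟨τ⟩]`
(`Δ_E < 0`) norms realise every order `≤ 2^M`, in contrast with the split case. [folklore] -/
theorem exists_norm_swap_eq (s : R) :
    ∃ v : R × R, v + (AddEquiv.prodComm : R × R ≃+ R × R) v = (s, s) :=
  ⟨(s, 0), by simp⟩

end FreeCase

/-! ### What the crux's Kolyvagin-prime condition says at `p = 2` (appended, same seat) -/

section ZhangPrimes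

open Literature.NumberTheory.EllipticCurves
open scoped NumberField

/-- **What the crux's prime condition says at `p = 2`.** For the congruence form of Kolyvagin
primes used by `KolyvaginExactAtTwo` (Zhang 2014, Notations (xii):
`M(ℓ) = min{v_p(ℓ+1), v_p(a_ℓ)} > 0`), at `p = 2` the index condition is just "`a_ℓ` is even":
`v₂(ℓ + 1) ≥ 1` is automatic for an odd prime `ℓ`. So `Zhang2014.IsKolyvaginPrime N W K 2 ℓ` iff
`ℓ` is an odd prime with `ℓ ∤ N`, `ℓ ∤ d_K`, `(ℓ)` prime in `𝓞_K`, and `2 ∣ a_ℓ` — a condition on the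
characteristic polynomial `X² − a_ℓX + ℓ ≡ (X + 1)² (mod 2)` only, which does NOT fix the conjugacy
class of `Frob_ℓ` in `Gal(ℚ(E[2])/ℚ) ≅ S₃` (identity or a transposition), whereas Kolyvagin's /
Gross's condition (tree `IsKolyvaginPrime`, Gross (3.2) `Frob(ℓ) = Frob(∞)`) does; for odd `p` the
two agree (`X² − 1` has distinct roots). [cite: WZhang2014, Notations (xii)] [cite: GrossLMS1991, §3 (3.2)–(3.3)] -/
theorem zhang_isKolyvaginPrime_two_iff (N : ℕ) (W : WeierstrassCurve ℚ) [W.IsGloballyMinimal]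
    (K : Type) [Field K] [NumberField K] (ℓ : ℕ) :
    Zhang2014.IsKolyvaginPrime N W K 2 ℓ ↔
      ℓ.Prime ∧ ¬ ℓ ∣ N ∧ ¬ ((ℓ : ℤ) ∣ NumberField.discr K) ∧ ℓ ≠ 2 ∧
        (Ideal.span {(ℓ : 𝓞 K)}).IsPrime ∧ (2 : ℤ) ∣ W.frobeniusTrace ℓ := by
  haveI : Fact (Nat.Prime 2) := ⟨Nat.prime_two⟩
  unfold Zhang2014.IsKolyvaginPrime
  refine ⟨fun ⟨hp, hN, hD, h2, hI, hM⟩ ↦ ⟨hp, hN, hD, h2, hI, ?_⟩,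
    fun ⟨hp, hN, hD, h2, hI, ha⟩ ↦ ⟨hp, hN, hD, h2, hI, ?_⟩⟩
  · have h := (Zhang2014.le_kolyvaginIndex_iff (W := W) (p := 2) (M := 1) (ℓ := ℓ)).mp hM
    simpa using h.2
  · refine (Zhang2014.le_kolyvaginIndex_iff (W := W) (p := 2) (M := 1) (ℓ := ℓ)).mpr ⟨?_, ?_⟩
    · rw [pow_one]
      rcases hp.eq_two_or_odd with h | h
      · exact absurd h h2
      · omega
    · simpa using ha

end ZhangPrimes

/-! ### Kolyvagin's local operator `(a_ℓ − (ℓ+1)F)/p^M` is a unit multiple of `(F² − 1)/p^M` (appended) -/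

section LocalOperator

/-- **Kolyvagin's local operator is a unit multiple of `F² − 1`.** In a commutative ring, if `F`
satisfies the Frobenius equation `F ^ 2 = a * F - l` (characteristic polynomial `X² − a_ℓX + ℓ` of
`Frob_ℓ` on `T₂E`), then `(a - (l + 1) * F) * F = -(l * (F ^ 2 - 1))`. Consequence (McCallum 1991
Prop. 4.4 (2), first clause, WITHOUT eigenspaces, hence valid at `p = 2`): Kolyvagin's operator
`u = (a_ℓ − (ℓ+1)F)/p^M`, whose value on `P̃` is the local class `χ_ℓ(P)(σ_ℓ)`, equals
`−ℓ F⁻¹ (F² − 1)/p^M` on `T₂E`; since `F² − 1` is injective on `T₂E` and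
`Ẽ(𝔽_λ)[p^∞] = T/(F² − 1)T`, `ker χ_ℓ = p^M E(K_λ)` for EVERY prime `ℓ` with `p^M ∣ ℓ + 1`,
`p^M ∣ a_ℓ` — the printed argument ("the eigenspaces of `Ẽ(𝔽_λ)` are cyclic") is not needed.
Apply in the commutative subring `ℤ₂[F] ⊂ End(T₂E)`. [cite: McCallumLMS1991, §4 Prop. 4.4 (2)] -/
theorem kolyvagin_localOperator_mul_frob {A : Type*} [CommRing A] (F a l : A)
    (h : F ^ 2 = a * F - l) : (a - (l + 1) * F) * F = -(l * (F ^ 2 - 1)) := by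
  linear_combination (-1 : A) * h

/-- The same with `F` invertible: `a - (l + 1) * F = -(l * F⁻¹ * (F ^ 2 - 1))` in the form
`(a - (l + 1) * F) * F * G = -(l * (F ^ 2 - 1)) * G` for any `G` with `F * G = 1`, i.e.
`a - (l + 1) * F = -(l * (F ^ 2 - 1) * G)`. [cite: McCallumLMS1991, §4 Prop. 4.4 (2)] -/
theorem kolyvagin_localOperator_eq {A : Type*} [CommRing A] (F G a l : A)
    (h : F ^ 2 = a * F - l) (hG : F * G = 1) : a - (l + 1) * F = -(l * (F ^ 2 - 1) * G) := by
  have h1 := kolyvagin_localOperator_mul_frob F a l h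
  calc a - (l + 1) * F = (a - (l + 1) * F) * (F * G) := by rw [hG, mul_one]
    _ = (a - (l + 1) * F) * F * G := by ring
    _ = -(l * (F ^ 2 - 1)) * G := by rw [h1]
    _ = -(l * (F ^ 2 - 1) * G) := by ring

end LocalOperator

/-! ### Signs in the local pairing of `τ`-norms: where a port of Cor. 5.6 to `p = 2` leaks a factor `2` (appended) -/

section WeilSigns

variable {A Z : Type*} [AddCommGroup A] [AddCommGroup Z] (W : A →+ A →+ Z) (τ : A →+ A)

/-- **Signs in the local Tate/Weil pairing of `τ`-norms** (McCallum 1991 Lemma 5.3 / Thm 5.4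
(16)–(18), made sign-explicit). Let `W` be biadditive with `W (τ x) (τ y) = - W x y` for an
involution `τ` (complex conjugation, or `Frob_ℓ` at a Kolyvagin prime, acts on `μ_{p^M}` by `−1`).
Then for all integers `ε, η`:
`W (a + ε • τ a) (b + η • τ b) = (1 - ε * η) • W a b + (η - ε) • W a (τ b)`.
[cite: McCallumLMS1991, §5 Lemma 5.3] -/
theorem pairing_norm_norm (hW : ∀ x y, W (τ x) (τ y) = -W x y) (hτ : ∀ x, τ (τ x) = x)
    (ε η : ℤ) (a b : A) :
    W (a + ε • τ a) (b + η • τ b) = (1 - ε * η) • W a b + (η - ε) • W a (τ b) := by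
  have h1 : W (τ a) b = -W a (τ b) := by
    conv_lhs => rw [← hτ b]
    rw [hW]
  have h2 : W (τ a) (τ b) = -W a b := hW a b
  simp only [map_add, map_zsmul, AddMonoidHom.add_apply, AddMonoidHom.zsmul_apply, h1, h2,
    smul_neg]
  module

/-- **Opposite McCallum signs are orthogonal** (`η = ε`, `ε² = 1`): `W (a + ε τ a) (b + ε τ b) = 0`
— at odd `p` this is "the `+` and `−` eigenspaces are orthogonal" (Gross Prop. 8.1 (2)); it holds
verbatim at `p = 2`. [cite: McCallumLMS1991, §5 Lemma 5.3] [cite: GrossLMS1991, §8 Prop. 8.1 (2)] -/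
theorem pairing_norm_norm_same (hW : ∀ x y, W (τ x) (τ y) = -W x y) (hτ : ∀ x, τ (τ x) = x)
    {ε : ℤ} (hε : ε * ε = 1) (a b : A) : W (a + ε • τ a) (b + ε • τ b) = 0 := by
  rw [pairing_norm_norm W τ hW hτ, hε, sub_self, sub_self, zero_smul, zero_smul, add_zero]

/-- **Equal McCallum signs pair into `2 • (…)`** (`η = −ε`, `ε² = 1`):
`W (a + ε τ a) (b - ε τ b) = 2 • W a (b - ε τ b)`. At odd `p` the `2` is a unit and this is
McCallum's "two elements in the same eigenspace whose orders multiply to more than `p^M` pair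
non-trivially"; at `p = 2` it shows that EVERY local duality step between a derived class (a
`τ`-eigenclass, Gross Prop. 5.4) and an eigen-type class loses one factor `2` — the obstruction to
porting the EXACT order formula (Cor. 5.6) to `p = 2` recorded in ANALYSIS-22137 §8.
[cite: McCallumLMS1991, §5 Lemma 5.3, Thm. 5.4] -/
theorem pairing_norm_norm_opposite (hW : ∀ x y, W (τ x) (τ y) = -W x y) (hτ : ∀ x, τ (τ x) = x)
    {ε : ℤ} (hε : ε * ε = 1) (a b : A) :
    W (a + ε • τ a) (b + (-ε) • τ b) = 2 • W a (b + (-ε) • τ b) := by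
  rw [pairing_norm_norm W τ hW hτ, mul_neg, hε, map_add, map_zsmul]
  module

end WeilSigns

/-! ### `ker χ_ℓ = p^M E(K_λ)` without eigenspaces: the module-theoretic core (appended) -/

section KerChi

variable {T : Type*} [AddCommGroup T] (G : T →+ T) (φ : T ≃+ T)

/-- **`ker χ_ℓ = p^M E(K_λ)` without eigenspaces (module-theoretic core).** Let `G` be an INJECTIVE
additive endomorphism of `T` (`(F² − 1)/p^M` on `T = T_pE`, injective since `|Frob_ℓ| = √ℓ`) and `φ`
an automorphism commuting with `G` (the unit `−ℓ F⁻¹`), `u = φ ∘ G` (Kolyvagin's operator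
`(a_ℓ − (ℓ+1)F)/p^M`, `kolyvagin_localOperator_eq`). Then for every `t : T` and every `N`
(`= p^M`): `u t ∈ N • G(T)` iff `t ∈ N • T`. Since `Ẽ(𝔽_λ)[p^∞] = T / p^M G(T)` and `χ_ℓ(P)` is the
class of `u P̃`, this says `ker χ_ℓ = p^M E(K_λ)` — McCallum 1991 Prop. 4.4 (2), first clause, at ANY
prime `p` (the printed proof uses cyclicity of the `±`-eigenspaces of `Ẽ(𝔽_λ)`, false at `p = 2`
when `E[2] ⊂ E(𝔽_ℓ)`). [cite: McCallumLMS1991, §4 Prop. 4.4 (2)] -/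
theorem exists_comp_eq_nsmul_iff (hG : Function.Injective G) (hφ : ∀ t, φ (G t) = G (φ t))
    (N : ℕ) (t : T) : (∃ s : T, φ (G t) = N • G s) ↔ ∃ s : T, t = N • s := by
  have hφ' : ∀ t, φ.symm (G t) = G (φ.symm t) := by
    intro t
    apply φ.injective
    rw [φ.apply_symm_apply, hφ, φ.apply_symm_apply]
  constructor
  · rintro ⟨s, hs⟩
    refine ⟨φ.symm s, hG ?_⟩
    have h := congrArg φ.symm hs
    rw [φ.symm_apply_apply, map_nsmul, hφ'] at h
    rw [h, map_nsmul]
  · rintro ⟨s, rfl⟩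
    exact ⟨φ s, by rw [map_nsmul, map_nsmul, hφ]⟩

end KerChi

end Summit.BirchSwinnertonDyer.BirchSwinnertonDyer.Theorems.GenusExact
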